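import Mathlib
import Summits.ValiantsHypothesis.ValiantsHypothesis.Theorems.RigidityForcesSymmetryRankRigidMinimalReprLaplaceFiveSeparatedCaptureDisjointPair
import Summits.ValiantsHypothesis.ValiantsHypothesis.Theorems.RigidityForcesSymmetryRankRigidMinimalReprLaplaceFiveSeparatedCaptureProlongationFive

/-!
# ValiantsHypothesis / RigidityForcesSymmetry — crux `LaplaceOptimalFive` (stmt-ValiantsHypothesis-24813), symmetric capture:
# ★★ **`CaptureIneqSym` FOR TWO DISJOINT SPANS OF TOTAL DIMENSION ≤ 4 AND A SPAN OF DIMENSION ≤ 2**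

Corollary (val-port-2 g5 ↔ crit-3 g9, 2026-08-29) of the profile-free injection ✓ `finrank_le_prolong_of_disjoint`
(`finrank W ≤ finrank (U₀₁ ⊔ U₀₂)⁽¹⁾` for `U₀₁ ⊓ U₀₂ = ⊥`, `finrank U₁₂ ≤ 2`) and the growth bounds for the prolongation
✓ `finrank_prolong_le_one/two/four` (val-lit-p6 g18, P5) and ✓ `finrank_prolong_le_five` (P5b, Macaulay-sharp `h₂ = 4 ⇒ h₃ ≤ 5`):
for `finrank U₀₁ + finrank U₀₂ ≤ 4` the capture inequality `finrank W ≤ finrank U₀₁ + finrank U₀₂ + finrank U₁₂` holds — profiles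
`(2,2,≤2)`, `(1,3,≤2)`, `(3,1,≤2)`, `(0,4,≤2)` with `U₀₁ ∩ U₀₂ = 0`, on top of ✓ `captureIneqSym_of_disjoint_pair` (total dimension ≤ 3).
The case `U₁₂ = ⊥` (where `4 ↦ 5` would overshoot) is ✓ `captureIneqSym_of_third_bot`.

* ★★ `captureIneqSym_of_disjoint_pair_four` — the theorem.

Honest framing.  Disjoint pairs of total dimension ≥ 5, intersecting pairs beyond two lines, `CaptureIneqSym` in general, K1 on `K₃ ⊔ K₂`,
`LaplaceOptimalFive` (OPEN · CONTESTED 72/120) and `VP ≠ VNP` are NOT proved here.  No definitions, no `sorry`.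
-/

set_option linter.dupNamespace false
set_option autoImplicit false

namespace Summit.ValiantsHypothesis.ValiantsHypothesis.Theorems.RigidityForcesSymmetryRankRigidMinimalRepr

namespace LaplaceFiveSeparatedCapture

open Finset

/-- ★★ **`CaptureIneqSym` FOR TWO DISJOINT SPANS OF TOTAL DIMENSION ≤ 4 AND A SPAN OF DIMENSION ≤ 2.** [folklore] -/
theorem captureIneqSym_of_disjoint_pair_four (U01 U02 U12 W : Submodule ℂ (Fin 5 → Fin 5 → ℂ))
    (h01 : ∀ x ∈ U01, ∀ p q : Fin 5, x p q = x q p) (h02 : ∀ x ∈ U02, ∀ p q : Fin 5, x p q = x q p)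
    (h12 : ∀ x ∈ U12, ∀ p q : Fin 5, x p q = x q p) (hdis : U01 ⊓ U02 = ⊥)
    (h4 : Module.finrank ℂ U01 + Module.finrank ℂ U02 ≤ 4) (hd : Module.finrank ℂ U12 ≤ 2)
    (hWs : ∀ μ ∈ W, ∀ s t : Fin 5, μ s t = μ t s) (hWd : ∀ μ ∈ W, ∀ s : Fin 5, μ s s = 0)
    (hWc : ∀ μ ∈ W, contractZ μ ∈ L3 U01 U02 U12) :
    Module.finrank ℂ W ≤ Module.finrank ℂ U01 + Module.finrank ℂ U02 + Module.finrank ℂ U12 := by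
  by_cases h3 : Module.finrank ℂ U01 + Module.finrank ℂ U02 ≤ 3
  · exact captureIneqSym_of_disjoint_pair U01 U02 U12 W h01 h02 h12 hdis h3 hd hWs hWd hWc
  by_cases h0 : Module.finrank ℂ U12 = 0
  · have hbot : U12 = ⊥ := Submodule.finrank_eq_zero.mp h0
    subst hbot
    have := captureIneqSym_of_third_bot U01 U02 W h01 h02 hWs hWd hWc
    omega
  have h := finrank_le_prolong_of_disjoint U01 U02 U12 W h01 h02 h12 hdis hd hWs hWd hWc
  have hXs : ∀ x ∈ U01 ⊔ U02, ∀ q r : Fin 5, x q r = x r q := by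
    intro x hx q r
    obtain ⟨y, hy, z, hz, rfl⟩ := Submodule.mem_sup.mp hx
    simp only [Pi.add_apply, h01 y hy q r, h02 z hz q r]
  have hX : Module.finrank ℂ ↥(U01 ⊔ U02) ≤ Module.finrank ℂ U01 + Module.finrank ℂ U02 :=
    Submodule.finrank_add_le_finrank_add_finrank U01 U02
  have := finrank_prolong_le_five (U01 ⊔ U02) hXs (by omega)
  omega

end LaplaceFiveSeparatedCapture

end Summit.ValiantsHypothesis.ValiantsHypothesis.Theorems.RigidityForcesSymmetryRankRigidMinimalRepr
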